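import Literature.MathematicalPhysics.QuantumFieldTheory.QuasiLocalGaugePerturbation
import Literature.MathematicalPhysics.QuantumFieldTheory.Balaban1983to89.StrongCouplingTorusWindow
import Literature.MathematicalPhysics.QuantumFieldTheory.TorusPlaquetteNeighbours
import Literature.Probability.LatticeModels.DobrushinComparisonMetric
import Summits.Ventures.YMGap.RobustBall.RobustSlabLaw
import HarnessLib

/-!
# RobustBall/Defs — the objects of track Y2 (ROBUST-BALL): loads, balls, sub-balls, the perturbed torus
specification and the conclusion predicates (rb-theory, design v0.2, 2026-08-22)

HONEST FRAMING: DEFINITIONS only (the two `theorem`s are consistency checks `0 ∈ ball`). Strong-coupling /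
high-temperature LATTICE statements only: nothing about the continuum limit or a Clay-sense mass gap.
This file types `HOME/rb/ROBUST-BALL-DESIGN.md` §2–§3: the per-link LOADS of a quasi-local gauge-invariant
perturbation `W` of the Wilson action (tree carrier `QuasiLocalGaugePerturbation d L (SU N) 1`) — oscillation
load `a(e)`, self-Lipschitz load `ℓ_s(e)`, cross-Lipschitz loads `ℓ(e,y)` and their sum `Λ(e)` — the tier-1
finite-range ball `ClusterDomainFR ε₀ ε₁ r`, the tier-2 diameter-weighted ball `ClusterDomain κ ε₀ ε₁`, the
area-law sub-ball `IsSlabLocal m` (centre-slab invariance + vertical dependence window), the plaquette rung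
`IsPlaquetteLocal` / `IsPlaquetteAction` (ds-4 S6), the perturbed torus specification `perturbedTorusSpec W β`,
and the CONCLUSION predicates rows are proved of: `RobustTorusDoor` (tier-1 Dobrushin door), `RobustTorusDoorW`
(tier-2 weighted door, the `hroww` shape of the tree's `DobrushinMetric.abs_covariance_le_of_isKRContraction_exp_dist`),
`TorusClusteringOnBall` / `TorusClusteringOnBallW` / `TorusClusteringOnBallUpTo`, `AreaLawOnBall`.
The prover-facing TARGET `Prop`s (U0–U5, bridges, witnesses, rows) are in `RobustBall/Targets.lean`; the `ℤ^d`
mass-gap ball is rb-p1's `RobustBall/MassGapOnBall.lean` (`PerturbedMassGapAt`, `MemBallZd`, `MassGapOnBallZd`,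
same loads over `(W, supp)`), not duplicated here.

UNITS. Every predicate here takes the TREE coupling `β` of `wilsonMeasure ρ β` / `W.expectation ρ β` (plaquette
weight `exp(−β(N − Re tr U_p))`; `SU(2)`: `β = β_W/2`, 't Hooft `βt = β/N = β_W/4`).
-/

noncomputable section

open MeasureTheory ProbabilityTheory Finset Function
open scoped NNReal
open Literature.Probability.LatticeModels Literature.Probability.LatticeModels.DobrushinMetric
open Literature.MathematicalPhysics.QuantumLattice hiding torusNorm
open Literature.MathematicalPhysics.QuantumFieldTheory hiding ZdEdge
open Literature.MathematicalPhysics.QuantumFieldTheory.Balaban1983to89.StrongCouplingTorusWindow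
  (wilsonPlaqWeight tField tInfluence)
open Literature.MathematicalPhysics.QuantumFieldTheory.Balaban1983to89.StrongCouplingDobrushinWindow
  (OneLinkKRModulus)

namespace Summit.Ventures.YMGap.RobustBall

/-! ## PART 1 — objects on the torus -/

/-- `SU(N)` as a type. [folklore] -/
abbrev SUN (N : ℕ) : Type := Matrix.specialUnitaryGroup (Fin N) ℂ

variable {d L N : ℕ} [NeZero L]

/-- The carrier of the ball: quasi-local gauge-invariant perturbations of the torus Wilson action at
block scale `1` (polymers = finite SITE sets `X`, links of `X` = `polymerEdges 1 X`). [folklore] -/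
abbrev Perturbation (d L N : ℕ) [NeZero L] : Type :=
  QuasiLocalGaugePerturbation d L (SUN N) 1

/-! ### Geometry of polymers: diameter, polymers through a link -/

/-- Torus `ℓ∞`-diameter of a site set (`torusNorm` of differences). [folklore] -/
def polymerDiam (X : Finset (Site d L)) : ℕ :=
  X.sup fun x => X.sup fun y => torusNorm (x - y)

/-- The polymers (site sets at block scale `1`) one of whose links is `e`. [folklore] -/
def polymersThroughEdge (e : Edge d L) : Finset (Finset (Site d L)) :=
  (polymers (d := d) (L := L) 1).filter fun X => e ∈ polymerEdges 1 X

/-- Finite range `r`: activities of polymers of diameter `> r` vanish. [folklore] -/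
def HasRange (r : ℕ) (W : Perturbation d L N) : Prop :=
  ∀ X, r < polymerDiam X → W.act X = 0

/-! ### Load witnesses and loads -/

/-- A WITNESS of per-link oscillation and Lipschitz bounds of every activity `W_X`: `osc X` is a
single-link oscillation bound of `W_X` (tree `Dobrushin.IsOscBound`: `|W_X σ − W_X τ| ≤ osc X e` when
`σ = τ` off `e`) and `lip X` a coordinatewise `suFrobDist`-Lipschitz bound (tree `IsLipBound`) — the same
two witness predicates as rb-p1's `ℤ^d` door `isKRContraction_perturbedYM_SU`. [folklore] -/
structure LoadWitness (W : Perturbation d L N) where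
  /-- oscillation bound of `W_X` in the link `e` -/
  osc : Finset (Site d L) → Edge d L → ℝ
  /-- Lipschitz bound of `W_X` in the link `y` for the Frobenius distance -/
  lip : Finset (Site d L) → Edge d L → ℝ
  osc_spec : ∀ X, Dobrushin.IsOscBound (W.act X) (osc X)
  lip_spec : ∀ X, IsLipBound suFrobDist (W.act X) (lip X)

namespace LoadWitness

variable {W : Perturbation d L N} (w : LoadWitness W)

/-- Weighted OSCILLATION LOAD at the link `e`: `∑_{X ∋ e} e^{κ diam X} osc_e(W_X)` (`κ = 0`: plain load `a`). [folklore] -/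
def oscLoad (κ : ℝ) (e : Edge d L) : ℝ :=
  ∑ X ∈ polymersThroughEdge e, Real.exp (κ * polymerDiam X) * w.osc X e

/-- Weighted SELF-LIPSCHITZ LOAD at `e`: `∑_{X ∋ e} e^{κ diam X} Lip_e(W_X)` (`ℓ_s`). [folklore] -/
def selfLipLoad (κ : ℝ) (e : Edge d L) : ℝ :=
  ∑ X ∈ polymersThroughEdge e, Real.exp (κ * polymerDiam X) * w.lip X e

/-- Weighted CROSS-LIPSCHITZ coefficient `ℓ_κ(e,y) = ∑_{X ∋ e, y} e^{κ diam X} Lip_y(W_X)` (`y ≠ e`). [folklore] -/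
def crossLip (κ : ℝ) (e y : Edge d L) : ℝ :=
  ∑ X ∈ (polymersThroughEdge e).filter (fun X => y ∈ polymerEdges 1 X),
    Real.exp (κ * polymerDiam X) * w.lip X y

/-- Weighted CROSS-LIPSCHITZ LOAD at `e`: `Λ_κ(e) = ∑_{y ≠ e} ℓ_κ(e,y)`. [folklore] -/
def crossLipLoad (κ : ℝ) (e : Edge d L) : ℝ :=
  ∑ y ∈ univ.erase e, w.crossLip κ e y

end LoadWitness

/-! ### The balls -/

/-- `W` has PER-LINK loads `a_κ(e) ≤ ε₀` and `ℓ_{s,κ}(e) + Λ_κ(e) ≤ ε₁` at EVERY link `e`, for SOME load witness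
(per-link, not global sups: the Dobrushin row at `e` is affine in `(ℓ_s(e), Λ(e))`, so the vertex bound `rhoFR` is
legitimate — rb-ref RB-2 F2). [folklore] -/
def InBall (κ ε₀ ε₁ : ℝ) (W : Perturbation d L N) : Prop :=
  ∃ w : LoadWitness W, (∀ e, w.oscLoad κ e ≤ ε₀) ∧ (∀ e, w.selfLipLoad κ e + w.crossLipLoad κ e ≤ ε₁)

/-- **TIER 1 ball** `ClusterDomainFR ε₀ ε₁ r`: finite range `r`, oscillation load `≤ ε₀`, self + cross
Lipschitz load `≤ ε₁` (unweighted). Runs on the tree's finite-`nbr` Dobrushin doors. [folklore] -/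
def ClusterDomainFR (ε₀ ε₁ : ℝ) (r : ℕ) : Set (Perturbation d L N) :=
  {W | HasRange r W ∧ InBall 0 ε₀ ε₁ W}

/-- **TIER 2 ball** `ClusterDomain κ ε₀ ε₁`: no range cut-off, loads weighted by `e^{κ · diam X}`. On the TORUS
its door is `RobustTorusDoorW` (weighted row sums), run on the landed weighted Kantorovich–Rubinstein engine
`DobrushinMetric.abs_covariance_le_of_isKRContraction_exp_dist` (Föllmer 1988 Cor. (2.14)/(2.24); crux Y2-X1a,
closed); on `ℤ^d` the infinite-range engine (Y2-X1b) is lit-1's `DobrushinMetricInfiniteRange` (summable weighted rows,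
global KR bound; Föllmer (2.5)–(2.23)). [folklore] -/
def ClusterDomain (κ ε₀ ε₁ : ℝ) : Set (Perturbation d L N) :=
  {W | InBall κ ε₀ ε₁ W}

/-! ### The area-law sub-ball: centre-slab invariance and vertical dependence diameter -/

/-- Multiply the `v`-directed links at `v`-height `t` by `z` (used with `z` central). [folklore] -/
def centerSlabRotate (v : Fin d) (t : ZMod L) (z : SUN N) (U : GaugeConfig d L (SUN N)) :
    GaugeConfig d L (SUN N) :=
  fun e => if e.2 = v ∧ e.1 v = t then z * U e else U e

/-- The links that are NOT `v`-directed, together with the `v`-directed links at the `m` consecutive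
`v`-heights `t₀, t₀+1, …, t₀+m−1`. [folklore] -/
def slabWindow (v : Fin d) (t₀ : ZMod L) (m : ℕ) : Set (Edge d L) :=
  {e | e.2 ≠ v ∨ ∃ k : ℕ, k < m ∧ e.1 v = t₀ + k}

/-- VERTICAL DEPENDENCE DIAMETER `≤ m`: for every direction `v`, every activity `W_X` depends, among the
`v`-directed links, only on those at `m` consecutive `v`-heights (a `DependsOn` statement on the FUNCTION, so a
plaquette term has `m = 1` and a `1×2` rectangle `m = 2`, irrespective of the coarser link set `polymerEdges 1 X`;
rb-p2's `HasVerticalRange` is the same datum on `W.total` slab by slab). [folklore] -/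
def HasVertRange (m : ℕ) (W : Perturbation d L N) : Prop :=
  ∀ (X : Finset (Site d L)) (v : Fin d), ∃ t₀ : ZMod L, DependsOn (W.act X) (slabWindow v t₀ m)

/-- `IsSlabLocal m W`: (i) the total perturbation is invariant under every centre rotation of one slab
of vertical links (rb-p2's hypothesis `hWc`; excludes Polyakov-loop terms) and (ii) vertical dependence
diameter `≤ m`. (i) FOLLOWS from (ii), per-activity gauge invariance (carrier field `gaugeInvariant'`) and
`m < L` — target `IsSlabLocalOfVertRangeTarget`; it is kept as a field so that rb-p2's reduction consumes it
by name. [folklore] -/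
structure IsSlabLocal (m : ℕ) (W : Perturbation d L N) : Prop where
  center_inv : ∀ (v : Fin d) (t : ZMod L) (z : SUN N), z ∈ Subgroup.center (SUN N) →
    ∀ U, W.total (centerSlabRotate v t z U) = W.total U
  vert_range : HasVertRange m W

/-! ### The plaquette rung (ds-4 S6): plaquette-local class-function members -/

/-- Every active polymer activity reads the configuration only through the four links of ONE plaquette
(members with `diam X = 1`; rows through this class are labelled «plaquette rung», rb-ref T0.6). [folklore] -/
def IsPlaquetteLocal (W : Perturbation d L N) : Prop :=
  ∀ X, W.act X ≠ 0 → ∃ q : Plaquette d L, DependsOn (W.act X) (↑(plaqEdgesT q) : Set (Edge d L))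

/-- The total perturbation is a plaquette action with ONE density `f` (a class function in applications):
`W.total U = ∑_q f(U_q)`. [folklore] -/
def IsPlaquetteAction (f : SUN N → ℝ) (W : Perturbation d L N) : Prop :=
  ∀ U, W.total U = ∑ q : Plaquette d L, f (plaquetteHolonomy U q.1 q.2.1.1 q.2.1.2)

/-! ### The perturbed torus specification -/

/-- The perturbed torus specification of `SU(N)` at tree coupling `β` (plaquette weight
`exp(−β(N − Re tr U_p))`, `wilsonPlaqWeight N β`) and perturbation `W`: product Haar on the links of `Λ`,
glued with `η`, tilted by the volume-independent energy `∑_q log v_β(U_q) − W.total`. At `W = 0` this is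
the tree's `torusWeightSpec (wilsonPlaqWeight N β)`. [folklore] -/
def perturbedTorusSpec (W : Perturbation d L N) (β : ℝ) : Specification (Edge d L) (SUN N) :=
  fun Λ η => ((Measure.pi fun _ : ↥Λ => haarProbability (SUN N)).map (glueWith Λ · η)).tilted
    fun U => torusLogWeight (wilsonPlaqWeight N β) U - W.total U

/-- Consistency: at `W = 0` the perturbed specification is the torus Wilson weight specification. [folklore] -/
theorem perturbedTorusSpec_zero (β : ℝ) :
    perturbedTorusSpec (0 : Perturbation d L N) β = torusWeightSpec (wilsonPlaqWeight N β) := by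
  funext Λ η
  simp [perturbedTorusSpec, torusWeightSpec]

/-! ### Conclusion predicates (what the provers prove rows of) -/

/-- **Robust torus Dobrushin door (tier 1)** at `(β, ε₀, ε₁, r)` with row-sum bound `ρ`: on every torus `L ≥ 3`,
every member's perturbed specification is a Kantorovich–Rubinstein contraction for `suFrobDist` with
some finite neighbourhoods of range `≤ r ⊔ 1` and row sums `≤ ρ`. (rb-p1, DESIGN §5 U3.) [folklore] -/
def RobustTorusDoor (N d : ℕ) (β ε₀ ε₁ : ℝ) (r : ℕ) (ρ : ℝ) : Prop :=
  ∀ (L : ℕ) [NeZero L], 3 ≤ L → ∀ W : Perturbation d L N, W ∈ ClusterDomainFR ε₀ ε₁ r →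
    ∃ (nbr : Edge d L → Finset (Edge d L)) (C : Edge d L → Edge d L → ℝ),
      IsKRContraction (perturbedTorusSpec W β) suFrobDist nbr C ∧
        (∀ e, ∑ y ∈ nbr e, C e y ≤ ρ) ∧ (∀ e, ∀ y ∈ nbr e, torusNorm (e.1 - y.1) ≤ max r 1)

/-- **Robust torus Dobrushin door (tier 2, WEIGHTED rows)** at `(β, κ, ε₀, ε₁)`: every member of the tier-2 ball
is a KR contraction whose rows weighted by `e^{t‖e−y‖_∞}` are `≤ ρ` — the hypothesis `hroww` of
`abs_covariance_le_of_isKRContraction_exp_dist` with `d e y = ‖e.1 − y.1‖_∞`. Expected entry: `t = κ`,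
`ρ = rhoFR N (e^{κ} c_W) ε₀ ε₁` (`‖e−y‖ ≤ diam X` for `X ∋ e, y`; plaquette neighbours at distance `≤ 1`). [folklore] -/
def RobustTorusDoorW (N d : ℕ) (β κ ε₀ ε₁ t ρ : ℝ) : Prop :=
  ∀ (L : ℕ) [NeZero L], 3 ≤ L → ∀ W : Perturbation d L N, W ∈ ClusterDomain κ ε₀ ε₁ →
    ∃ (nbr : Edge d L → Finset (Edge d L)) (C : Edge d L → Edge d L → ℝ),
      IsKRContraction (perturbedTorusSpec W β) suFrobDist nbr C ∧
        ∀ e, ∑ y ∈ nbr e, C e y * Real.exp (t * torusNorm (e.1 - y.1)) ≤ ρ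

/-- `W` CLUSTERS at tree coupling `β` with constant `A` and rate `m`: for bounded measurable local observables
`f, g` with coordinatewise Lipschitz bounds, the covariance under the MEMBER's measure `μ_{β,W,L}` decays at rate
`m` in the torus distance between the supports (the body shared by tier 1, tier 2 and ym3ir's `ClustersWith`). [folklore] -/
def ClustersWith (W : Perturbation d L N) (β A m : ℝ) : Prop :=
  ∀ (f g : GaugeConfig d L (SUN N) → ℝ) (Δf Δg : Finset (Edge d L)) (δf δg : Edge d L → ℝ) (n : ℕ),
    Measurable f → Measurable g → DependsOn f (↑Δf : Set (Edge d L)) →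
    DependsOn g (↑Δg : Set (Edge d L)) → (∃ M, ∀ U, |f U| ≤ M) → (∃ M, ∀ U, |g U| ≤ M) →
    IsLipBound suFrobDist f δf → IsLipBound suFrobDist g δg →
    (∀ x ∈ Δf, ∀ y ∈ Δg, n ≤ torusNorm (x.1 - y.1)) →
      |cov[f, g; W.perturbedMeasure (fundamentalRep (Fin N)) β]| ≤
        A * (∑ y ∈ Δg, δg y) * (∑ x ∈ Δf, δf x) * Real.exp (-m * n)

/-- **Torus-uniform exponential clustering on the tier-1 ball** (currency C-MGT): every torus `L ≥ 3`, every
member, ONE constant `A` and ONE rate `m` depending on `(N, d, β, ε₀, ε₁, r)` only. [folklore] -/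
def TorusClusteringOnBall (N d : ℕ) (β ε₀ ε₁ : ℝ) (r : ℕ) (A m : ℝ) : Prop :=
  ∀ (L : ℕ) [NeZero L], 3 ≤ L → ∀ W : Perturbation d L N, W ∈ ClusterDomainFR ε₀ ε₁ r → ClustersWith W β A m

/-- **Torus-uniform exponential clustering on the tier-2 ball.** [folklore] -/
def TorusClusteringOnBallW (N d : ℕ) (β κ ε₀ ε₁ : ℝ) (A m : ℝ) : Prop :=
  ∀ (L : ℕ) [NeZero L], 3 ≤ L → ∀ W : Perturbation d L N, W ∈ ClusterDomain κ ε₀ ε₁ → ClustersWith W β A m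

/-- **Clustering on the ball UP TO `β⋆`** (ym3ir-theory-1's receiving currency): every tree coupling
`0 ≤ β ≤ β⋆`. Follows from the rows because every load is `β`-free and the Wilson constant is increasing in `β`. [folklore] -/
def TorusClusteringOnBallUpTo (N d : ℕ) (βs ε₀ ε₁ : ℝ) (r : ℕ) (A m : ℝ) : Prop :=
  ∀ β : ℝ, 0 ≤ β → β ≤ βs → TorusClusteringOnBall N d β ε₀ ε₁ r A m

/-- **Area law on the ball** (currency C-AL): constants `C, c > 0` such that for every torus `L`, every
member `W` of the tier-1 ball which is slab-local with vertical diameter `mv`, and every rectangular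
`R × T` Wilson loop, `|⟨W_{R×T}⟩_{β,W,L}| ≤ C^{2(R+T)} e^{−c R T}` — the tree's `HasAreaLaw` with
`wilsonExpectation` replaced by the member's `W.expectation`. Expected constants from rb-p2's reduction:
`c = C₂/(2 mv)`, `C = max N e^{c M₀²}`, `M₀ = 2 log max((N²)^{mv}·4C₁, 1)/C₂`. [folklore] -/
def AreaLawOnBall (N d : ℕ) (β ε₀ ε₁ : ℝ) (r mv : ℕ) : Prop :=
  ∃ C c : ℝ, 0 < c ∧ ∀ (L : ℕ) [NeZero L] (W : Perturbation d L N), W ∈ ClusterDomainFR ε₀ ε₁ r →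
    IsSlabLocal mv W → ∀ (x : Site d L) (i j : Fin d) (R T : ℕ), i ≠ j → 1 ≤ R → 1 ≤ T →
      2 * R ≤ L → 2 * T ≤ L →
        |W.expectation (fundamentalRep (Fin N)) β (wilsonLoop (fundamentalRep (Fin N)) x i j R T)| ≤
          C ^ (2 * (R + T)) * Real.exp (-c * (R * T))

/-- Consistency target (T1.3): the ball area law contains Wilson's (`W = 0` is a member). [folklore] -/
def AreaLawOnBallConsistency (N d : ℕ) (β ε₀ ε₁ : ℝ) (r mv : ℕ) : Prop :=
  AreaLawOnBall N d β ε₀ ε₁ r mv → HasAreaLaw d (fundamentalRep (Fin N)) β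

/-- The zero perturbation is in every tier-1 ball with nonnegative radii. [folklore] -/
theorem zero_mem_clusterDomainFR {ε₀ ε₁ : ℝ} (h₀ : 0 ≤ ε₀) (h₁ : 0 ≤ ε₁) (r : ℕ) :
    (0 : Perturbation d L N) ∈ ClusterDomainFR ε₀ ε₁ r := by
  refine ⟨fun X _ => rfl, ?_⟩
  refine ⟨⟨fun _ _ => 0, fun _ _ => 0, ?_, ?_⟩, ?_, ?_⟩
  · intro X; exact ⟨fun _ => le_rfl, fun y σ τ _ => by simp⟩
  · intro X; exact ⟨fun _ => le_rfl, fun y σ τ _ => by simp⟩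
  · intro e; simp [LoadWitness.oscLoad, h₀]
  · intro e; simp [LoadWitness.selfLipLoad, LoadWitness.crossLipLoad, LoadWitness.crossLip, h₁]

/-- The zero perturbation is in every tier-2 ball with nonnegative radii. [folklore] -/
theorem zero_mem_clusterDomain {κ ε₀ ε₁ : ℝ} (h₀ : 0 ≤ ε₀) (h₁ : 0 ≤ ε₁) :
    (0 : Perturbation d L N) ∈ ClusterDomain κ ε₀ ε₁ := by
  refine ⟨⟨fun _ _ => 0, fun _ _ => 0, ?_, ?_⟩, ?_, ?_⟩
  · intro X; exact ⟨fun _ => le_rfl, fun y σ τ _ => by simp⟩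
  · intro X; exact ⟨fun _ => le_rfl, fun y σ τ _ => by simp⟩
  · intro e; simp [LoadWitness.oscLoad, h₀]
  · intro e; simp [LoadWitness.selfLipLoad, LoadWitness.crossLipLoad, LoadWitness.crossLip, h₁]

end Summit.Ventures.YMGap.RobustBall

end
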